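import Summits.SmoothPoincare4.SmoothPoincare4.Theorems.SymplecticOrigamiGromovRecognitionRelEndStubCapModelAux3
import Mathlib.Analysis.SpecialFunctions.SmoothTransition

/-!
# Wedge cap for `GromovRecognitionRelEnd` — the radial profiles and the four model forms
(stub `stub_capModel` of line `cross-cap-laurent`, crux `SymplecticOrigami.GromovRecognitionRelEnd`,
item stmt-SmoothPoincare4-11009; fourth auxiliary file)

The closed `2`-form of the wedge cap is `Ω[f, f] = f(|z₁|²) dx₀∧dx₁ + f(|z₂|²) dx₂∧dx₃` on the end,
for a smooth positive RADIAL PROFILE `f = fProf R₁` with `f ≡ 1` on `(-∞, R₁²]` (so `Ω[f,f] = ω₀`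
on the ball of radius `R₁`) and `f(s) = 1/s²` for `s ≥ S₀` (so that in the inverted coordinate
`u = 1/z₁` the area form `f(|z₁|²) dx₀∧dx₁ = f(|u|⁻²)|u|⁻⁴ du₀∧du₁` is the CONSTANT form `du₀∧du₁`
near the sphere at infinity `u = 0`). The transformed profile `G = GProf R₁` (`G(s) = f(1/s)/s²`
for `s > 0`, `G ≡ 1` near `s ≤ 0`) is again smooth and positive, and the four model forms
`ΩM = Ω[f,f]`, `ΩV = Ω[G,f]`, `ΩH = Ω[f,G]`, `ΩC = Ω[G,G]` are exchanged by the inversions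
(`ΩM_pullback_inv1 : inv1^* ΩM = ΩV`, …), which is the consistency of the cap form on the
overlaps of the charts. Interpolation by `Real.smoothTransition`.
-/

noncomputable section

-- the registered namespace `Summit.SmoothPoincare4.SmoothPoincare4.Theorems…` repeats a component
set_option linter.dupNamespace false

open scoped Manifold ContDiff Topology
open Set Literature.Geometry.Kaehler Literature.Geometry.Symplectic

namespace Summit.SmoothPoincare4.SmoothPoincare4.Theorems.GromovRecognitionRelEnd.CrossCapLaurent

namespace CapModel

/-- Model space `ℝ⁴ = ℂ²` (coordinates `0,1` = `z₁`, `2,3` = `z₂`). -/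
local notation "E4" => EuclideanSpace ℝ (Fin 4)

/-! ## The radial profile -/

/-- The tail profile `g(s) = 1/(s² + (1 - χ(s-1)))`: smooth and positive on `ℝ`, equal to `1/s²`
for `s ≥ 2`. [folklore] -/
def gProf (s : ℝ) : ℝ := (s ^ 2 + (1 - Real.smoothTransition (s - 1)))⁻¹

/-- The denominator of `gProf` is positive. [folklore] -/
theorem gProf_denom_pos (s : ℝ) : 0 < s ^ 2 + (1 - Real.smoothTransition (s - 1)) := by
  by_cases hs : 1 ≤ s
  · have h1 : 0 ≤ 1 - Real.smoothTransition (s - 1) := sub_nonneg.2 (Real.smoothTransition.le_one _)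
    have h2 : 0 < s ^ 2 := by positivity
    linarith
  · rw [Real.smoothTransition.zero_of_nonpos (by linarith)]
    positivity

/-- `gProf > 0`. [folklore] -/
theorem gProf_pos (s : ℝ) : 0 < gProf s := inv_pos.2 (gProf_denom_pos s)

/-- `gProf` is smooth. [folklore] -/
theorem contDiff_gProf : ContDiff ℝ ∞ gProf := by
  have h : ContDiff ℝ ∞ fun s : ℝ => s ^ 2 + (1 - Real.smoothTransition (s - 1)) :=
    (contDiff_id.pow 2).add (contDiff_const.sub
      (Real.smoothTransition.contDiff.comp (contDiff_id.sub contDiff_const)))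
  exact h.inv fun s => (gProf_denom_pos s).ne'

/-- `gProf s = 1/s²` for `s ≥ 2`. [folklore] -/
theorem gProf_eq {s : ℝ} (hs : 2 ≤ s) : gProf s = (s ^ 2)⁻¹ := by
  rw [gProf, Real.smoothTransition.one_of_one_le (by linarith)]; ring_nf

/-- **The radial profile** `f(s) = (1 - χ(s - R₁²)) + χ(s - R₁²) g(s)`: `≡ 1` on `(-∞, R₁²]`,
`= 1/s²` for large `s`, smooth and positive. [folklore] -/
def fProf (R₁ : ℝ) (s : ℝ) : ℝ :=
  1 - Real.smoothTransition (s - R₁ ^ 2) + Real.smoothTransition (s - R₁ ^ 2) * gProf s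

/-- `fProf` is smooth. [folklore] -/
theorem contDiff_fProf (R₁ : ℝ) : ContDiff ℝ ∞ (fProf R₁) := by
  have hχ : ContDiff ℝ ∞ fun s : ℝ => Real.smoothTransition (s - R₁ ^ 2) :=
    Real.smoothTransition.contDiff.comp (contDiff_id.sub contDiff_const)
  exact (contDiff_const.sub hχ).add (hχ.mul contDiff_gProf)

/-- `fProf > 0` (a convex combination of `1` and `g > 0`). [folklore] -/
theorem fProf_pos (R₁ s : ℝ) : 0 < fProf R₁ s := by
  unfold fProf
  have h0 := Real.smoothTransition.nonneg (s - R₁ ^ 2)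
  have h1 := Real.smoothTransition.le_one (s - R₁ ^ 2)
  have hg := gProf_pos s
  rcases eq_or_lt_of_le h0 with h | h
  · rw [← h]; norm_num
  · nlinarith

/-- `fProf ≡ 1` on `(-∞, R₁²]`. [folklore] -/
theorem fProf_eq_one {R₁ s : ℝ} (hs : s ≤ R₁ ^ 2) : fProf R₁ s = 1 := by
  rw [fProf, Real.smoothTransition.zero_of_nonpos (by linarith)]; ring

/-- The threshold `S₀ = max (R₁² + 1) 2` beyond which `fProf = 1/s²`. [folklore] -/
def S₀ (R₁ : ℝ) : ℝ := max (R₁ ^ 2 + 1) 2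

/-- `S₀ > 0`. [folklore] -/
theorem S₀_pos (R₁ : ℝ) : 0 < S₀ R₁ := lt_of_lt_of_le (by norm_num) (le_max_right _ _)

/-- `fProf s = 1/s²` for `s ≥ S₀`. [folklore] -/
theorem fProf_eq_inv_sq {R₁ s : ℝ} (hs : S₀ R₁ ≤ s) : fProf R₁ s = (s ^ 2)⁻¹ := by
  have h1 : R₁ ^ 2 + 1 ≤ s := le_trans (le_max_left _ _) hs
  have h2 : 2 ≤ s := le_trans (le_max_right _ _) hs
  rw [fProf, Real.smoothTransition.one_of_one_le (by linarith), gProf_eq h2]; ring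

/-- In the inverted variable, `fProf` becomes `1` near `0`: `hatP f s = 1` for `0 < s ≤ S₀⁻¹`.
[folklore] -/
theorem hatP_fProf_eq_one {R₁ s : ℝ} (hs : 0 < s) (hs' : s ≤ (S₀ R₁)⁻¹) : hatP (fProf R₁) s = 1 := by
  have h1 : S₀ R₁ ≤ s⁻¹ := by
    rw [← inv_inv (S₀ R₁)]
    exact inv_anti₀ hs hs'
  rw [hatP_apply, fProf_eq_inv_sq h1]
  field_simp

/-- **The transformed profile** `G(s) = f(1/s)/s²` for `s > 0`, `G(s) = 1` for `s ≤ 0`; smooth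
because `f(1/s)/s² = 1` for `0 < s ≤ S₀⁻¹`. [folklore] -/
def GProf (R₁ : ℝ) (s : ℝ) : ℝ := if 0 < s then hatP (fProf R₁) s else 1

/-- For `s > 0`, `G = hatP f`. [folklore] -/
theorem GProf_of_pos {R₁ s : ℝ} (hs : 0 < s) : GProf R₁ s = hatP (fProf R₁) s := by
  simp only [GProf, hs, if_true]

/-- `G ≡ 1` on `(-∞, S₀⁻¹]`. [folklore] -/
theorem GProf_eq_one {R₁ s : ℝ} (hs : s ≤ (S₀ R₁)⁻¹) : GProf R₁ s = 1 := by
  by_cases h : 0 < s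
  · rw [GProf_of_pos h, hatP_fProf_eq_one h hs]
  · simp only [GProf, h, if_false]

/-- `G > 0`. [folklore] -/
theorem GProf_pos (R₁ s : ℝ) : 0 < GProf R₁ s := by
  by_cases h : 0 < s
  · rw [GProf_of_pos h]; exact hatP_pos (fProf_pos R₁) h.ne'
  · simp only [GProf, h, if_false]; exact one_pos

/-- `G` is smooth. [folklore] -/
theorem contDiff_GProf (R₁ : ℝ) : ContDiff ℝ ∞ (GProf R₁) := by
  rw [contDiff_iff_contDiffAt]
  intro s
  by_cases hs : 0 < s
  · -- near `s > 0`, `G = hatP f`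
    have hev : GProf R₁ =ᶠ[𝓝 s] fun t => fProf R₁ t⁻¹ * t⁻¹ ^ 2 := by
      filter_upwards [isOpen_Ioi.mem_nhds (mem_Ioi.2 hs)] with t ht
      rw [GProf_of_pos (mem_Ioi.1 ht), hatP_apply]
    refine ContDiffAt.congr_of_eventuallyEq ?_ hev
    have hinv : ContDiffAt ℝ ∞ (fun t : ℝ => t⁻¹) s := contDiffAt_inv ℝ hs.ne'
    exact (((contDiff_fProf R₁).contDiffAt).comp s hinv).mul (hinv.pow 2)
  · -- near `s ≤ 0`, `G = 1`
    have hev : GProf R₁ =ᶠ[𝓝 s] fun _ => 1 := by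
      have hmem : Iio (S₀ R₁)⁻¹ ∈ 𝓝 s :=
        isOpen_Iio.mem_nhds (lt_of_le_of_lt (not_lt.1 hs) (inv_pos.2 (S₀_pos R₁)))
      filter_upwards [hmem] with t ht
      exact GProf_eq_one (le_of_lt ht)
    exact contDiffAt_const.congr_of_eventuallyEq hev

/-- **`hatP G = f` for `s > 0`** (the inversion is an involution on profiles). [folklore] -/
theorem hatP_GProf {R₁ s : ℝ} (hs : 0 < s) : hatP (GProf R₁) s = fProf R₁ s := by
  rw [hatP_apply, GProf_of_pos (inv_pos.2 hs), ← hatP_apply, hatP_hatP _ hs.ne']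

/-! ## The four model forms and their exchange under the inversions -/

/-- The END form `ΩM = f(|z₁|²) dx₀∧dx₁ + f(|z₂|²) dx₂∧dx₃` (`= ω₀` on the ball of radius `R₁`). [folklore] -/
def ΩM (R₁ : ℝ) : MForm (𝓡 4) E4 ℝ 2 := capForm (fProf R₁) (fProf R₁)
/-- The form of the `V`-cap chart `(u, z₂)`: `ΩV = G(|u|²) du₀∧du₁ + f(|z₂|²) dx₂∧dx₃`. [folklore] -/
def ΩV (R₁ : ℝ) : MForm (𝓡 4) E4 ℝ 2 := capForm (GProf R₁) (fProf R₁)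
/-- The form of the `H`-cap chart `(z₁, t)`: `ΩH = f(|z₁|²) dx₀∧dx₁ + G(|t|²) dt₀∧dt₁`. [folklore] -/
def ΩH (R₁ : ℝ) : MForm (𝓡 4) E4 ℝ 2 := capForm (fProf R₁) (GProf R₁)
/-- The form of the corner chart `(u, t)`: `ΩC = G(|u|²) du₀∧du₁ + G(|t|²) dt₀∧dt₁`. [folklore] -/
def ΩC (R₁ : ℝ) : MForm (𝓡 4) E4 ℝ 2 := capForm (GProf R₁) (GProf R₁)

/-- Split radial forms only see the values of the profiles at `|z₁|²`, `|z₂|²`. [folklore] -/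
theorem capForm_congr {a a' b b' : ℝ → ℝ} {p : E4} (ha : a (r1 p) = a' (r1 p))
    (hb : b (r2 p) = b' (r2 p)) : capForm a b p = capForm a' b' p := by
  show capFormE a b p = capFormE a' b' p
  simp only [capFormE, ha, hb]

variable (R₁ : ℝ)

/-- **`inv1^* ΩM = ΩV`** off the axis `z₁ = 0`. [folklore] -/
theorem ΩM_pullback_inv1 {p : E4} (h : r1 p ≠ 0) : (ΩM R₁).pullback 𝓘(ℝ, E4) inv1 p = ΩV R₁ p := by
  rw [ΩM, capForm_pullback_inv1 _ _ h, ΩV]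
  exact capForm_congr (GProf_of_pos (lt_of_le_of_ne (r1_nonneg p) (Ne.symm h))).symm rfl

/-- **`inv2^* ΩH = ΩM`** off the axis `z₂ = 0`. [folklore] -/
theorem ΩH_pullback_inv2 {p : E4} (h : r2 p ≠ 0) : (ΩH R₁).pullback 𝓘(ℝ, E4) inv2 p = ΩM R₁ p := by
  rw [ΩH, capForm_pullback_inv2 _ _ h, ΩM]
  exact capForm_congr rfl (hatP_GProf (lt_of_le_of_ne (r2_nonneg p) (Ne.symm h)))

/-- **`inv1^* ΩV = ΩM`** off the axis `z₁ = 0`. [folklore] -/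
theorem ΩV_pullback_inv1 {p : E4} (h : r1 p ≠ 0) : (ΩV R₁).pullback 𝓘(ℝ, E4) inv1 p = ΩM R₁ p := by
  rw [ΩV, capForm_pullback_inv1 _ _ h, ΩM]
  exact capForm_congr (hatP_GProf (lt_of_le_of_ne (r1_nonneg p) (Ne.symm h))) rfl

/-- **`inv2^* ΩC = ΩV`** off the axis `z₂ = 0`. [folklore] -/
theorem ΩC_pullback_inv2 {p : E4} (h : r2 p ≠ 0) : (ΩC R₁).pullback 𝓘(ℝ, E4) inv2 p = ΩV R₁ p := by
  rw [ΩC, capForm_pullback_inv2 _ _ h, ΩV]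
  exact capForm_congr rfl (hatP_GProf (lt_of_le_of_ne (r2_nonneg p) (Ne.symm h)))

/-- **`inv1^* ΩC = ΩH`** off the axis `z₁ = 0`. [folklore] -/
theorem ΩC_pullback_inv1 {p : E4} (h : r1 p ≠ 0) : (ΩC R₁).pullback 𝓘(ℝ, E4) inv1 p = ΩH R₁ p := by
  rw [ΩC, capForm_pullback_inv1 _ _ h, ΩH]
  exact capForm_congr (hatP_GProf (lt_of_le_of_ne (r1_nonneg p) (Ne.symm h))) rfl

/-- **`ΩM = ω₀` on the ball of radius `R₁`** (indeed wherever `|z₁|², |z₂|² ≤ R₁²`). [folklore] -/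
theorem ΩM_apply_of_le {p : E4} (h1 : r1 p ≤ R₁ ^ 2) (h2 : r2 p ≤ R₁ ^ 2) (v w : E4) :
    ΩM R₁ p ![v, w] = stdSymplecticForm v w :=
  capForm_apply_of_eq_one (fProf_eq_one h1) (fProf_eq_one h2) v w

/-- `ΩM = ω₀` at the points of norm `≤ R₁`. [folklore] -/
theorem ΩM_apply_of_norm_le {p : E4} (h : ‖p‖ ≤ R₁) (v w : E4) :
    ΩM R₁ p ![v, w] = stdSymplecticForm v w := by
  have h2 : ‖p‖ ^ 2 ≤ R₁ ^ 2 := pow_le_pow_left₀ (norm_nonneg p) h 2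
  exact ΩM_apply_of_le R₁ ((r1_le_norm_sq p).trans h2) ((r2_le_norm_sq p).trans h2) v w

/-- The four model forms are smooth. [folklore] -/
theorem isSmoothForm_models :
    IsSmoothForm (ΩM R₁) ∧ IsSmoothForm (ΩV R₁) ∧ IsSmoothForm (ΩH R₁) ∧ IsSmoothForm (ΩC R₁) :=
  ⟨isSmoothForm_capForm (contDiff_fProf R₁) (contDiff_fProf R₁),
    isSmoothForm_capForm (contDiff_GProf R₁) (contDiff_fProf R₁),
    isSmoothForm_capForm (contDiff_fProf R₁) (contDiff_GProf R₁),
    isSmoothForm_capForm (contDiff_GProf R₁) (contDiff_GProf R₁)⟩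

/-- The four model forms are closed. [folklore] -/
theorem isClosedForm_models :
    IsClosedForm (ΩM R₁) ∧ IsClosedForm (ΩV R₁) ∧ IsClosedForm (ΩH R₁) ∧ IsClosedForm (ΩC R₁) :=
  ⟨isClosedForm_capForm (contDiff_fProf R₁) (contDiff_fProf R₁),
    isClosedForm_capForm (contDiff_GProf R₁) (contDiff_fProf R₁),
    isClosedForm_capForm (contDiff_fProf R₁) (contDiff_GProf R₁),
    isClosedForm_capForm (contDiff_GProf R₁) (contDiff_GProf R₁)⟩

/-- The four model forms tame `i ⊕ i`. [cite: McDuffSalamon2017, §4.1 (4.1.1)] -/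
theorem models_I4_pos (p : E4) {q : E4} (hq : q ≠ 0) :
    0 < ΩM R₁ p ![q, I4 q] ∧ 0 < ΩV R₁ p ![q, I4 q] ∧ 0 < ΩH R₁ p ![q, I4 q] ∧
      0 < ΩC R₁ p ![q, I4 q] :=
  ⟨capForm_I4_pos (fProf_pos R₁) (fProf_pos R₁) p hq,
    capForm_I4_pos (GProf_pos R₁) (fProf_pos R₁) p hq,
    capForm_I4_pos (fProf_pos R₁) (GProf_pos R₁) p hq,
    capForm_I4_pos (GProf_pos R₁) (GProf_pos R₁) p hq⟩

end CapModel

/-- **Registered helper sub-goal `helper_capModelProfile`** (fourth auxiliary file of stub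
`stub_capModel`): for every `R₁` there is a smooth positive radial profile `f` with `f ≡ 1` on
`(-∞, R₁²]` and `f(s) = 1/s²` for all large `s` (the profile of the cap form). [folklore] -/
theorem helper_capModelProfile : ∀ R₁ : ℝ, ∃ (f : ℝ → ℝ) (S : ℝ), ContDiff ℝ ∞ f ∧ (∀ s, 0 < f s) ∧
    (∀ s, s ≤ R₁ ^ 2 → f s = 1) ∧ ∀ s, S ≤ s → f s = (s ^ 2)⁻¹ :=
  fun R₁ => ⟨CapModel.fProf R₁, CapModel.S₀ R₁, CapModel.contDiff_fProf R₁, CapModel.fProf_pos R₁,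
    fun _ hs => CapModel.fProf_eq_one hs, fun _ hs => CapModel.fProf_eq_inv_sq hs⟩

end Summit.SmoothPoincare4.SmoothPoincare4.Theorems.GromovRecognitionRelEnd.CrossCapLaurent
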